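import Summits.CriticalPhenomena.PercolationContinuityZ3.Theorems.PercNearOneGluingNoHeavyLowerTailCILHyperedgeTools
import Literature.Probability.Percolation.LonelyClusterExchange
import HarnessLib

/-!
# `NoHeavyLowerTail` (stmt-CriticalPhenomena-4575) — the two-sided core with a TWO-PORT star reduces to the HYPEREDGE inequality

Support file (prover `prim-hp-2`, deletion–contraction / pivotal-edge line; `--supports stmt-CriticalPhenomena-4575`).
No definitions, no named facts, no sorries.  Tools: `…CILHyperedgeTools`.

Notation: `μ_w = prodBernoulli w` on `Fin n`, relays `A`, level `j`, `π(v) = {z ∈ A : v ↔ z}`, `π(S) = ⋃_{v∈S} π(v)`, lightness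
`I_w(x) = μ_w{|π(x)| ≤ j}`, `CS_w(S, i) : μ_w(i ↮ S, 1 ≤ |π(S)| ≤ j) ≤ μ_w(i ↮ S, |π(i)| ≤ j)` (as in `observerSet_le_of_lonelier`).
The OPEN TWO-SIDED CORE of the hull-port residual (`…CILTwoPendantStars` (TPS), `HullPort.setCS_pair_of_oneSided`, crux notes of
prim-hp-2/3/6) is `CS_H({s₁,s₂}, i)` for two non-adjacent relay-neighboured non-relays `s₁, s₂` and a relay `i` dominating their ports
in `H` ITSELF.  Here `s₂` has exactly two ports `c, d` (coins `y_c, y_d`, `Y = y_c y_d`).  Peeling `s₂`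
(`Hyperedge.pair_expansion_twoPort`): `CSdiff = Σ_{B ⊆ {c,d}} μ(σ_B)·f_B`, `f_B = CSdiff_{w∖s₂}({s₁} ∪ B, i)`, hence
      `(1 − Y)·CSdiff_w({s₁,s₂}, i) = μ(σ_∅)·DD + μ(σ_c)·E_c + μ(σ_d)·E_d`,
`DD = (1−Y) f_∅ + Y f_{cd}` — the HYPEREDGE inequality: `s₂` attached to both ports with probability `Y`, else to nothing — and
`E_c = (1−Y) f_c + Y f_{cd} = CSdiff_{w^c}({s₁,s₂}, i)`, `w^c = w[s₂c ↦ 1, s₂d ↦ Y]`, which induces the SAME relay lightnesses as `w`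
(`Hyperedge.lightness_eq_of_sameGlue`, "series law"), so `E_c ≥ 0` is the lonelier-member lemma (member `s₂ ≡ c`) under
`I_w(c) ≤ I_w(i)`; likewise `E_d`.

* `setCS_pair_of_hyperedgeDD` — **`CS_w({s₁,s₂}, i)` follows from `I_w(c), I_w(d) ≤ I_w(i)` and `DD ≥ 0`** (every `j`, every `s₁`, every
  graph off `s₂`): the product law of a two-port star is a convex combination of its three extreme laws with gluing probability `Y`; the two
  contracted ones are free, the hyperedge law is the whole content.  prim-hp-2's crux notes (TPS-P2EQ2.md) prove `DD ≥ 0` for `j ≤ 2`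
  (strong CIL lemma) — the two-sided core at the `(5,2)` rung for every port shape with a two-port star; numerically `DD ≥ 0` has
  0 violations (1 585 random + climbs, n ≤ 9; ttrl2 request `tps-hyperedge-dd`).
-/

noncomputable section

namespace Summit.CriticalPhenomena.PercolationContinuityZ3.Theorems

open MeasureTheory Set Literature.Probability.LatticeModels Literature.Probability.Percolation
open scoped Classical BigOperators

variable {n : ℕ}

namespace Hyperedge

open CutObserver KNPreFKG

/-! ### Relay lightness sees a two-port star only through the product of its coins -/

/-- On the star `σ_B` of `o`, two vertices `x, z ≠ o` are joined iff they are joined off `o`, or both are joined off `o` to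
vertices of `B`. [folklore] -/
theorem reachable_iff_star {ω : BondConfig (Fin n)} {o : Fin n} {B : Finset (Fin n)}
    (hσ : ω ∈ starEvent o (↑B : Set (Fin n))) (hBo : ∀ y ∈ B, y ≠ o) {x z : Fin n} (hxo : x ≠ o) (hzo : z ≠ o) :
    (openGraph ω).Reachable x z ↔ (openGraph (ω ∩ {e | o ∉ e})).Reachable x z ∨
      ((∃ b ∈ B, (openGraph (ω ∩ {e | o ∉ e})).Reachable b x) ∧ ∃ b' ∈ B, (openGraph (ω ∩ {e | o ∉ e})).Reachable b' z) := by
  constructor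
  · intro hxz
    by_cases hxo' : (openGraph ω).Reachable x o
    · right
      obtain ⟨b, hb, hbx⟩ := exists_avoid_of_reachable_star hσ hxo hxo'.symm
      obtain ⟨b', hb', hb'z⟩ := exists_avoid_of_reachable_star hσ hzo (hxo'.symm.trans hxz)
      exact ⟨⟨b, Finset.mem_coe.1 hb, hbx⟩, ⟨b', Finset.mem_coe.1 hb', hb'z⟩⟩
    · exact Or.inl (reachable_avoiding_of_not_reachable hxo' hxz)
  · rintro (h | ⟨⟨b, hb, hbx⟩, ⟨b', hb', hb'z⟩⟩)
    · exact reachable_mono inter_subset_left h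
    · have h1 : (openGraph ω).Reachable o x := reachable_of_mem_star hσ (hBo b hb) (Finset.mem_coe.2 hb) hbx
      have h2 : (openGraph ω).Reachable o z := reachable_of_mem_star hσ (hBo b' hb') (Finset.mem_coe.2 hb') hb'z
      exact h1.symm.trans h2

/-- **Star expansion of the lightness of a relay.**  For `o ∉ A` whose positive-weight pairs end in `P` (`o ∉ P`) and a relay `x ∈ A`:
`μ{|π(x)| ≤ j} = Σ_{B ⊆ P} μ(σ_B)·μ{ω | g_B(ω ∩ {e | o ∉ e})}`, where `g_B(ξ)` says that at most `j` relays are `ξ`-joined to `x` or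
`ξ`-joined to `B` while `x` is `ξ`-joined to `B`. [folklore] -/
theorem lightness_star_expansion (u : Sym2 (Fin n) → unitInterval) (A : Finset (Fin n)) (o x : Fin n) (P : Finset (Fin n))
    (j : ℕ) (hoA : o ∉ A) (hxA : x ∈ A) (hoP : o ∉ P) (hobs : ∀ y, y ≠ o → y ∉ P → u s(o, y) = 0) :
    (prodBernoulli u).real {ω : BondConfig (Fin n) | (A.filter fun z => ω ∈ openConn x z).card ≤ j} =
      ∑ B ∈ P.powerset, (prodBernoulli u).real (starEvent o (↑B : Set (Fin n))) *
        (prodBernoulli u).real {ω : BondConfig (Fin n) |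
          (A.filter fun z => (openGraph (ω ∩ {e | o ∉ e})).Reachable x z ∨
            ((∃ b ∈ B, (openGraph (ω ∩ {e | o ∉ e})).Reachable b x) ∧
              ∃ b' ∈ B, (openGraph (ω ∩ {e | o ∉ e})).Reachable b' z)).card ≤ j} := by
  set μ := prodBernoulli u with hμ
  set E := {ω : BondConfig (Fin n) | (A.filter fun z => ω ∈ openConn x z).card ≤ j} with hE
  set g : Finset (Fin n) → BondConfig (Fin n) → Prop := fun B ξ =>
    (A.filter fun z => (openGraph ξ).Reachable x z ∨
      ((∃ b ∈ B, (openGraph ξ).Reachable b x) ∧ ∃ b' ∈ B, (openGraph ξ).Reachable b' z)).card ≤ j with hg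
  have hxo : x ≠ o := fun h => hoA (h ▸ hxA)
  rw [real_eq_sum_inter_starEvent u P o hoP hobs E]
  refine Finset.sum_congr rfl fun B hB => ?_
  have hBP : B ⊆ P := Finset.mem_powerset.1 hB
  have hBo : ∀ y ∈ B, y ≠ o := fun y hy h => hoP (h ▸ hBP hy)
  have hEq : E ∩ starEvent o (↑B : Set (Fin n)) = starEvent o (↑B : Set (Fin n)) ∩ {ω | g B (ω ∩ {e | o ∉ e})} := by
    ext ω
    simp only [hE, mem_inter_iff, mem_setOf_eq]
    constructor
    · rintro ⟨h, hω⟩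
      refine ⟨hω, ?_⟩
      have : (A.filter fun z => ω ∈ openConn x z) = (A.filter fun z => (openGraph (ω ∩ {e | o ∉ e})).Reachable x z ∨
          ((∃ b ∈ B, (openGraph (ω ∩ {e | o ∉ e})).Reachable b x) ∧
            ∃ b' ∈ B, (openGraph (ω ∩ {e | o ∉ e})).Reachable b' z)) :=
        Finset.filter_congr fun z hz => reachable_iff_star hω hBo hxo (fun h => hoA (h ▸ hz))
      simp only [hg]
      rw [← this]; exact h
    · rintro ⟨hω, h⟩
      refine ⟨?_, hω⟩
      have : (A.filter fun z => ω ∈ openConn x z) = (A.filter fun z => (openGraph (ω ∩ {e | o ∉ e})).Reachable x z ∨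
          ((∃ b ∈ B, (openGraph (ω ∩ {e | o ∉ e})).Reachable b x) ∧
            ∃ b' ∈ B, (openGraph (ω ∩ {e | o ∉ e})).Reachable b' z)) :=
        Finset.filter_congr fun z hz => reachable_iff_star hω hBo hxo (fun h => hoA (h ▸ hz))
      simp only [hg] at h
      rw [this]; exact h
  rw [hEq, measureReal_starEvent_inter_avoid u o ↑B (g B)]

/-- For a star `B` with at most one vertex the correction in `g_B` is void: being joined to `x` through a single vertex of `B` is being
joined to `x`. [folklore] -/
theorem lightness_star_term_of_card_le_one (A B : Finset (Fin n)) (x : Fin n) (j : ℕ) (hB : B.card ≤ 1)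
    (ξ : BondConfig (Fin n)) :
    ((A.filter fun z => (openGraph ξ).Reachable x z ∨
        ((∃ b ∈ B, (openGraph ξ).Reachable b x) ∧ ∃ b' ∈ B, (openGraph ξ).Reachable b' z)).card ≤ j) ↔
      ((A.filter fun z => (openGraph ξ).Reachable x z).card ≤ j) := by
  have hfilt : (A.filter fun z => (openGraph ξ).Reachable x z ∨
      ((∃ b ∈ B, (openGraph ξ).Reachable b x) ∧ ∃ b' ∈ B, (openGraph ξ).Reachable b' z)) =
      (A.filter fun z => (openGraph ξ).Reachable x z) := by
    refine Finset.filter_congr fun z _ => ⟨?_, fun h => Or.inl h⟩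
    rintro (h | ⟨⟨b, hb, hbx⟩, ⟨b', hb', hb'z⟩⟩)
    · exact h
    · have : b = b' := Finset.card_le_one.1 hB b hb b' hb'
      subst this
      exact hbx.symm.trans hb'z
  rw [hfilt]

/-- **Relay lightness depends on a two-port star only through the product of its two coins.**  Let `o ∉ A` have positive-weight pairs
only to `c ≠ d` (both `≠ o`) under two weight functions `u₁, u₂` which agree off `o` and have `u₁(oc)·u₁(od) = u₂(oc)·u₂(od)`.  Then every
relay `x ∈ A` has the same lightness under `u₁` and `u₂` (for the relays, the star of `o` acts only by gluing `c` to `d`, which happens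
with probability `u(oc)·u(od)`; "series law"). [folklore] -/
theorem lightness_eq_of_sameGlue (u₁ u₂ : Sym2 (Fin n) → unitInterval) (A : Finset (Fin n)) (o c d x : Fin n) (j : ℕ)
    (hoA : o ∉ A) (hxA : x ∈ A) (hco : c ≠ o) (hdo : d ≠ o) (hcd : c ≠ d)
    (hobs₁ : ∀ y, y ≠ o → u₁ s(o, y) ≠ 0 → y = c ∨ y = d) (hobs₂ : ∀ y, y ≠ o → u₂ s(o, y) ≠ 0 → y = c ∨ y = d)
    (hoff : ∀ e : Sym2 (Fin n), o ∉ e → u₁ e = u₂ e)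
    (hglue : (u₁ s(o, c) : ℝ) * u₁ s(o, d) = (u₂ s(o, c) : ℝ) * u₂ s(o, d)) :
    (prodBernoulli u₁).real {ω : BondConfig (Fin n) | (A.filter fun z => ω ∈ openConn x z).card ≤ j} =
      (prodBernoulli u₂).real {ω : BondConfig (Fin n) | (A.filter fun z => ω ∈ openConn x z).card ≤ j} := by
  set P : Finset (Fin n) := {c, d} with hP
  have hoP : o ∉ P := by simp [hP, hco.symm, hdo.symm]
  have hobs₁' : ∀ y, y ≠ o → y ∉ P → u₁ s(o, y) = 0 := by
    intro y hyo hyP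
    by_contra h
    rcases hobs₁ y hyo h with rfl | rfl <;> simp [hP] at hyP
  have hobs₂' : ∀ y, y ≠ o → y ∉ P → u₂ s(o, y) = 0 := by
    intro y hyo hyP
    by_contra h
    rcases hobs₂ y hyo h with rfl | rfl <;> simp [hP] at hyP
  -- the off-`o` factors agree
  set g : Finset (Fin n) → BondConfig (Fin n) → Prop := fun B ξ =>
    (A.filter fun z => (openGraph ξ).Reachable x z ∨
      ((∃ b ∈ B, (openGraph ξ).Reachable b x) ∧ ∃ b' ∈ B, (openGraph ξ).Reachable b' z)).card ≤ j with hg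
  have hwoff : (fun e => if e ∈ {e : Sym2 (Fin n) | o ∉ e} then u₁ e else 0) =
      (fun e => if e ∈ {e : Sym2 (Fin n) | o ∉ e} then u₂ e else 0) := by
    funext e
    by_cases he : o ∉ e
    · simp only [mem_setOf_eq, he, not_false_eq_true, if_true, hoff e he]
    · simp only [mem_setOf_eq, he, if_false]
  have hG : ∀ B : Finset (Fin n), (prodBernoulli u₁).real {ω | g B (ω ∩ {e | o ∉ e})} =
      (prodBernoulli u₂).real {ω | g B (ω ∩ {e | o ∉ e})} := by
    intro B
    have h1 : (prodBernoulli u₁).real {ω | g B (ω ∩ {e | o ∉ e})} =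
        (prodBernoulli fun e => if e ∈ {e : Sym2 (Fin n) | o ∉ e} then u₁ e else 0).real {ξ | g B ξ} :=
      measureReal_preimage_avoid u₁ o {ξ | g B ξ}
    have h2 : (prodBernoulli u₂).real {ω | g B (ω ∩ {e | o ∉ e})} =
        (prodBernoulli fun e => if e ∈ {e : Sym2 (Fin n) | o ∉ e} then u₂ e else 0).real {ξ | g B ξ} :=
      measureReal_preimage_avoid u₂ o {ξ | g B ξ}
    rw [h1, h2, hwoff]
  -- write each lightness as G_∅ + Y·(G_cd − G_∅)
  have key : ∀ (u : Sym2 (Fin n) → unitInterval), (∀ y, y ≠ o → u s(o, y) ≠ 0 → y = c ∨ y = d) →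
      (∀ y, y ≠ o → y ∉ P → u s(o, y) = 0) →
      (prodBernoulli u).real {ω : BondConfig (Fin n) | (A.filter fun z => ω ∈ openConn x z).card ≤ j} =
        (prodBernoulli u).real {ω | g ∅ (ω ∩ {e | o ∉ e})} +
          (u s(o, c) : ℝ) * u s(o, d) * ((prodBernoulli u).real {ω | g P (ω ∩ {e | o ∉ e})} -
            (prodBernoulli u).real {ω | g ∅ (ω ∩ {e | o ∉ e})}) := by
    intro u hobs hobs'
    rw [lightness_star_expansion u A o x P j hoA hxA hoP hobs']
    -- Σ_B ν_B g_B = Σ_B ν_B g_∅ + Σ_B ν_B (g_B − g_∅)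
    have hsplit : ∀ B ∈ P.powerset, (prodBernoulli u).real (starEvent o (↑B : Set (Fin n))) *
        (prodBernoulli u).real {ω | g B (ω ∩ {e | o ∉ e})} =
        (prodBernoulli u).real (starEvent o (↑B : Set (Fin n))) * (prodBernoulli u).real {ω | g ∅ (ω ∩ {e | o ∉ e})} +
        (prodBernoulli u).real (starEvent o (↑B : Set (Fin n))) *
          ((prodBernoulli u).real {ω | g B (ω ∩ {e | o ∉ e})} - (prodBernoulli u).real {ω | g ∅ (ω ∩ {e | o ∉ e})}) := by
      intro B _; ring
    rw [Finset.sum_congr rfl hsplit, Finset.sum_add_distrib, ← Finset.sum_mul]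
    -- Σ_B ν_B = 1
    have hone : ∑ B ∈ P.powerset, (prodBernoulli u).real (starEvent o (↑B : Set (Fin n))) = 1 := by
      have h := real_eq_sum_inter_starEvent u P o hoP hobs' Set.univ
      simp only [Set.univ_inter, probReal_univ] at h
      exact h.symm
    rw [hone, one_mul]
    congr 1
    -- only B = P contributes to the second sum
    rw [Finset.sum_eq_single P]
    · rw [(measureReal_starEvent_twoPort_cases u o c d hco hdo hcd hobs).2.2.2]
    · intro B hB hBP
      have hBsub : B ⊆ P := Finset.mem_powerset.1 hB
      have hcard : B.card ≤ 1 := by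
        have hlt : B.card < P.card := Finset.card_lt_card ⟨hBsub, fun h => hBP (Finset.Subset.antisymm hBsub h)⟩
        have hP2 : P.card ≤ 2 := by rw [hP]; exact Finset.card_insert_le _ _  |>.trans (by simp)
        omega
      have hev : {ω : BondConfig (Fin n) | g B (ω ∩ {e | o ∉ e})} = {ω | g ∅ (ω ∩ {e | o ∉ e})} := by
        ext ω
        simp only [mem_setOf_eq, hg]
        rw [lightness_star_term_of_card_le_one A B x j hcard, lightness_star_term_of_card_le_one A ∅ x j (by simp)]
      rw [hev, sub_self, mul_zero]
    · intro h; exact absurd (Finset.mem_powerset.2 (subset_refl P)) h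
  rw [key u₁ hobs₁ hobs₁', key u₂ hobs₂ hobs₂', hG ∅, hG P, hglue]

/-- If the pair `e` has weight `1`, every event has the same probability as its intersection with `{e open}`. [folklore] -/
theorem measureReal_eq_inter_open_of_weight_one (u : Sym2 (Fin n) → unitInterval) (e : Sym2 (Fin n)) (hu : u e = 1)
    (E : Set (BondConfig (Fin n))) :
    (prodBernoulli u).real E = (prodBernoulli u).real (E ∩ {ω | e ∈ ω}) := by
  have h0 : (prodBernoulli u).real {ω : BondConfig (Fin n) | e ∉ ω} = 0 := by
    rw [prodBernoulli_real_setOf_notMem, hu]; simp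
  refine le_antisymm ?_ (measureReal_mono inter_subset_left (measure_ne_top _ _))
  calc (prodBernoulli u).real E
      ≤ (prodBernoulli u).real (E ∩ {ω | e ∈ ω} ∪ {ω | e ∉ ω}) :=
        measureReal_mono (fun ω hω => by
          by_cases h : e ∈ ω
          · exact Or.inl ⟨hω, h⟩
          · exact Or.inr h) (measure_ne_top _ _)
    _ ≤ (prodBernoulli u).real (E ∩ {ω | e ∈ ω}) + (prodBernoulli u).real {ω : BondConfig (Fin n) | e ∉ ω} :=
        measureReal_union_le _ _
    _ = (prodBernoulli u).real (E ∩ {ω | e ∈ ω}) := by rw [h0, add_zero]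

end Hyperedge

open CutObserver KNPreFKG Hyperedge in
/-- **The two-sided core with a two-port star, from the hyperedge inequality.**  Let `s₁ ≠ s₂`, `s₂ ∉ A`, every positive-weight
pair at `s₂` ending in one of two relays `c ≠ d` (coins `y_c, y_d`, `Y = y_c y_d`), and let the relay `i ∈ A`, `i ≠ s₁`, satisfy
`I_w(c) ≤ I_w(i)`, `I_w(d) ≤ I_w(i)` (lightness in the graph ITSELF).  With `f_B = μ'(i ↮ {s₁} ∪ B, |π'(i)| ≤ j) − μ'(i ↮ {s₁} ∪ B,
1 ≤ |π'({s₁} ∪ B)| ≤ j)` read off `s₂`: IF `DD := (1 − Y)·f_∅ + Y·f_{cd} ≥ 0` THEN `CS_w({s₁,s₂}, i)`.  Proof: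
`(1−Y)·CSdiff = μ(σ_∅)·DD + μ(σ_c)·E_c + μ(σ_d)·E_d` with `E_c = CSdiff_{w^c}({s₁,s₂}, i) ≥ 0` (`w^c = w[s₂c ↦ 1, s₂d ↦ Y]`,
`observerSet_le_of_lonelier` with member `s₂`, `I_{w^c}(s₂) = I_{w^c}(c) = I_w(c) ≤ I_w(i) = I_{w^c}(i)`), likewise `E_d`; `Y = 1` reads
`CSdiff = E_c`.  For TPS take `s₁` the other pendant star and `i` the `H`-champion.
[cite: VandenbergHaggstromKahn2005, Thm. 1.5 (p. 7) — via Literature.Probability.Percolation.observerSet_le_of_lonelier] -/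
theorem setCS_pair_of_hyperedgeDD (w : Sym2 (Fin n) → unitInterval) (A : Finset (Fin n)) (s₁ s₂ c d i : Fin n) (j : ℕ)
    (hs₂A : s₂ ∉ A) (h12 : s₁ ≠ s₂) (hcA : c ∈ A) (hdA : d ∈ A) (hcd : c ≠ d) (hiA : i ∈ A) (hi1 : i ≠ s₁)
    (hobs : ∀ u, u ≠ s₂ → w s(s₂, u) ≠ 0 → u = c ∨ u = d)
    (hdomc : (prodBernoulli w).real {ω : BondConfig (Fin n) | (A.filter fun z => ω ∈ openConn c z).card ≤ j} ≤
      (prodBernoulli w).real {ω : BondConfig (Fin n) | (A.filter fun z => ω ∈ openConn i z).card ≤ j})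
    (hdomd : (prodBernoulli w).real {ω : BondConfig (Fin n) | (A.filter fun z => ω ∈ openConn d z).card ≤ j} ≤
      (prodBernoulli w).real {ω : BondConfig (Fin n) | (A.filter fun z => ω ∈ openConn i z).card ≤ j})
    (hDD : 0 ≤ (1 - (w s(s₂, c) : ℝ) * w s(s₂, d)) *
        ((prodBernoulli w).real {ω : BondConfig (Fin n) |
            (∀ y ∈ ({s₁} : Finset (Fin n)), ¬ (openGraph (ω ∩ {e | s₂ ∉ e})).Reachable i y) ∧
              (A.filter fun z => (openGraph (ω ∩ {e | s₂ ∉ e})).Reachable i z).card ≤ j} -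
          (prodBernoulli w).real {ω : BondConfig (Fin n) |
            (∀ y ∈ ({s₁} : Finset (Fin n)), ¬ (openGraph (ω ∩ {e | s₂ ∉ e})).Reachable i y) ∧
              1 ≤ (A.filter fun z => ∃ y ∈ ({s₁} : Finset (Fin n)), (openGraph (ω ∩ {e | s₂ ∉ e})).Reachable y z).card ∧
              (A.filter fun z => ∃ y ∈ ({s₁} : Finset (Fin n)), (openGraph (ω ∩ {e | s₂ ∉ e})).Reachable y z).card ≤ j}) +
      ((w s(s₂, c) : ℝ) * w s(s₂, d)) *
        ((prodBernoulli w).real {ω : BondConfig (Fin n) |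
            (∀ y ∈ ({s₁} ∪ {c, d} : Finset (Fin n)), ¬ (openGraph (ω ∩ {e | s₂ ∉ e})).Reachable i y) ∧
              (A.filter fun z => (openGraph (ω ∩ {e | s₂ ∉ e})).Reachable i z).card ≤ j} -
          (prodBernoulli w).real {ω : BondConfig (Fin n) |
            (∀ y ∈ ({s₁} ∪ {c, d} : Finset (Fin n)), ¬ (openGraph (ω ∩ {e | s₂ ∉ e})).Reachable i y) ∧
              1 ≤ (A.filter fun z => ∃ y ∈ ({s₁} ∪ {c, d} : Finset (Fin n)), (openGraph (ω ∩ {e | s₂ ∉ e})).Reachable y z).card ∧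
              (A.filter fun z => ∃ y ∈ ({s₁} ∪ {c, d} : Finset (Fin n)),
                (openGraph (ω ∩ {e | s₂ ∉ e})).Reachable y z).card ≤ j})) :
    (prodBernoulli w).real {ω : BondConfig (Fin n) | (∀ x ∈ ({s₁, s₂} : Finset (Fin n)), ω ∉ openConn i x) ∧
        1 ≤ (A.filter fun z => ∃ x ∈ ({s₁, s₂} : Finset (Fin n)), ω ∈ openConn x z).card ∧
        (A.filter fun z => ∃ x ∈ ({s₁, s₂} : Finset (Fin n)), ω ∈ openConn x z).card ≤ j} ≤
      (prodBernoulli w).real {ω : BondConfig (Fin n) | (∀ x ∈ ({s₁, s₂} : Finset (Fin n)), ω ∉ openConn i x) ∧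
        (A.filter fun z => ω ∈ openConn i z).card ≤ j} := by
  haveI : ∀ u : Sym2 (Fin n) → unitInterval, IsProbabilityMeasure (prodBernoulli u) := fun u => inferInstance
  have hcs : c ≠ s₂ := fun h => hs₂A (h ▸ hcA)
  have hds : d ≠ s₂ := fun h => hs₂A (h ▸ hdA)
  have hi2 : i ≠ s₂ := fun h => hs₂A (h ▸ hiA)
  have hne : s(s₂, c) ≠ s(s₂, d) := fun h => hcd (Sym2.congr_right.1 h)
  have hyc0 : 0 ≤ (w s(s₂, c) : ℝ) := (w s(s₂, c)).2.1
  have hyc1 : (w s(s₂, c) : ℝ) ≤ 1 := (w s(s₂, c)).2.2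
  have hyd0 : 0 ≤ (w s(s₂, d) : ℝ) := (w s(s₂, d)).2.1
  have hyd1 : (w s(s₂, d) : ℝ) ≤ 1 := (w s(s₂, d)).2.2
  have hYmem : (w s(s₂, c) : ℝ) * w s(s₂, d) ∈ unitInterval := unitInterval.mul_mem (w s(s₂, c)).2 (w s(s₂, d)).2
  -- the modified weight functions `w^c = w[s₂c ↦ 1, s₂d ↦ Y]`, `w^d = w[s₂d ↦ 1, s₂c ↦ Y]`
  set wc : Sym2 (Fin n) → unitInterval :=
    Function.update (Function.update w s(s₂, c) 1) s(s₂, d) ⟨(w s(s₂, c) : ℝ) * w s(s₂, d), hYmem⟩ with hwc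
  set wd : Sym2 (Fin n) → unitInterval :=
    Function.update (Function.update w s(s₂, d) 1) s(s₂, c) ⟨(w s(s₂, c) : ℝ) * w s(s₂, d), hYmem⟩ with hwd
  have hwc_ed : wc s(s₂, d) = ⟨(w s(s₂, c) : ℝ) * w s(s₂, d), hYmem⟩ := by rw [hwc, Function.update_self]
  have hwc_ec : wc s(s₂, c) = 1 := by rw [hwc, Function.update_of_ne hne, Function.update_self]
  have hwd_ec : wd s(s₂, c) = ⟨(w s(s₂, c) : ℝ) * w s(s₂, d), hYmem⟩ := by rw [hwd, Function.update_self]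
  have hwd_ed : wd s(s₂, d) = 1 := by rw [hwd, Function.update_of_ne hne.symm, Function.update_self]
  have hwc_ne : ∀ e : Sym2 (Fin n), e ≠ s(s₂, c) → e ≠ s(s₂, d) → wc e = w e := fun e h1 h2 => by
    rw [hwc, Function.update_of_ne h2, Function.update_of_ne h1]
  have hwd_ne : ∀ e : Sym2 (Fin n), e ≠ s(s₂, c) → e ≠ s(s₂, d) → wd e = w e := fun e h1 h2 => by
    rw [hwd, Function.update_of_ne h1, Function.update_of_ne h2]
  have hoff : ∀ e : Sym2 (Fin n), s₂ ∉ e → e ≠ s(s₂, c) ∧ e ≠ s(s₂, d) :=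
    fun e he => ⟨fun h => he (h ▸ Sym2.mem_mk_left s₂ c), fun h => he (h ▸ Sym2.mem_mk_left s₂ d)⟩
  have hwc_off : ∀ e : Sym2 (Fin n), s₂ ∉ e → wc e = w e := fun e he => hwc_ne e (hoff e he).1 (hoff e he).2
  have hwd_off : ∀ e : Sym2 (Fin n), s₂ ∉ e → wd e = w e := fun e he => hwd_ne e (hoff e he).1 (hoff e he).2
  have hobs' : ∀ (u : Sym2 (Fin n) → unitInterval), (∀ e : Sym2 (Fin n), e ≠ s(s₂, c) → e ≠ s(s₂, d) → u e = w e) →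
      ∀ y, y ≠ s₂ → u s(s₂, y) ≠ 0 → y = c ∨ y = d := by
    intro u hu y hy h
    by_cases hyc : y = c
    · exact Or.inl hyc
    by_cases hyd : y = d
    · exact Or.inr hyd
    rw [hu _ (fun h' => hyc (Sym2.congr_right.1 h')) (fun h' => hyd (Sym2.congr_right.1 h'))] at h
    exact hobs y hy h
  have hobs_c := hobs' wc hwc_ne
  have hobs_d := hobs' wd hwd_ne
  have h1r : ((1 : unitInterval) : ℝ) = 1 := Set.Icc.coe_one
  -- a pair of weight one glues (cf. `HullPort.lightness_eq_of_weight_one`): `I_u(s₂) = I_u(p)` when `u s(s₂,p) = 1`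
  have hsure : ∀ (u : Sym2 (Fin n) → unitInterval) (p : Fin n), s₂ ≠ p → u s(s₂, p) = 1 →
      (prodBernoulli u).real {ω : BondConfig (Fin n) | (A.filter fun z => ω ∈ openConn s₂ z).card ≤ j} =
        (prodBernoulli u).real {ω : BondConfig (Fin n) | (A.filter fun z => ω ∈ openConn p z).card ≤ j} := by
    intro u p hsp hu
    rw [measureReal_eq_inter_open_of_weight_one u s(s₂, p) hu,
      measureReal_eq_inter_open_of_weight_one u s(s₂, p) hu {ω : BondConfig (Fin n) | (A.filter fun z => ω ∈ openConn p z).card ≤ j}]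
    congr 1
    ext ω
    simp only [mem_inter_iff, mem_setOf_eq]
    constructor
    · rintro ⟨h, he⟩
      have hadj : (openGraph ω).Adj s₂ p := by rw [openGraph, SimpleGraph.fromEdgeSet_adj]; exact ⟨he, hsp⟩
      have heq : (A.filter fun z => ω ∈ openConn p z) = (A.filter fun z => ω ∈ openConn s₂ z) :=
        Finset.filter_congr fun z _ => ⟨fun hz => hadj.reachable.trans hz, fun hz => hadj.reachable.symm.trans hz⟩
      exact ⟨by rw [heq]; exact h, he⟩
    · rintro ⟨h, he⟩
      have hadj : (openGraph ω).Adj s₂ p := by rw [openGraph, SimpleGraph.fromEdgeSet_adj]; exact ⟨he, hsp⟩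
      have heq : (A.filter fun z => ω ∈ openConn s₂ z) = (A.filter fun z => ω ∈ openConn p z) :=
        Finset.filter_congr fun z _ => ⟨fun hz => hadj.reachable.symm.trans hz, fun hz => hadj.reachable.trans hz⟩
      exact ⟨by rw [heq]; exact h, he⟩
  -- E_c ≥ 0 and E_d ≥ 0: the lonelier-member lemma in `w^c`, `w^d`
  have hEc := observerSet_le_of_lonelier wc A ({s₁, s₂} : Finset (Fin n)) s₂ i (by simp) j (by
    rw [hsure wc c hcs.symm hwc_ec,
      lightness_eq_of_sameGlue wc w A s₂ c d c j hs₂A hcA hcs hds hcd hobs_c hobs hwc_off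
        (by rw [hwc_ec, hwc_ed, h1r, one_mul]),
      lightness_eq_of_sameGlue wc w A s₂ c d i j hs₂A hiA hcs hds hcd hobs_c hobs hwc_off
        (by rw [hwc_ec, hwc_ed, h1r, one_mul])]
    exact hdomc)
  have hEd := observerSet_le_of_lonelier wd A ({s₁, s₂} : Finset (Fin n)) s₂ i (by simp) j (by
    rw [hsure wd d hds.symm hwd_ed,
      lightness_eq_of_sameGlue wd w A s₂ c d d j hs₂A hdA hcs hds hcd hobs_d hobs hwd_off
        (by rw [hwd_ec, hwd_ed, h1r, mul_one]),
      lightness_eq_of_sameGlue wd w A s₂ c d i j hs₂A hiA hcs hds hcd hobs_d hobs hwd_off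
        (by rw [hwd_ec, hwd_ed, h1r, mul_one])]
    exact hdomd)
  have hEw := pair_expansion_twoPort w w A s₁ s₂ c d i j hs₂A h12 hi1 hi2 hcs hds hcd (fun e _ => rfl) hobs
  have hEc' := pair_expansion_twoPort w wc A s₁ s₂ c d i j hs₂A h12 hi1 hi2 hcs hds hcd hwc_off hobs_c
  have hEd' := pair_expansion_twoPort w wd A s₁ s₂ c d i j hs₂A h12 hi1 hi2 hcs hds hcd hwd_off hobs_d
  rw [sum_powerset_pair c d hcd] at hEw hEc' hEd'
  rw [hwc_ec, hwc_ed, h1r] at hEc'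
  rw [hwd_ec, hwd_ed, h1r] at hEd'
  have hcd' : c ∉ ({d} : Finset (Fin n)) := by rw [Finset.mem_singleton]; exact hcd
  have hdc' : d ∉ ({c} : Finset (Fin n)) := by rw [Finset.mem_singleton]; exact fun h => hcd h.symm
  simp only [if_pos (Finset.mem_singleton_self c), if_pos (Finset.mem_singleton_self d), if_neg (Finset.notMem_empty c),
    if_neg (Finset.notMem_empty d), if_neg hcd', if_neg hdc', if_pos (Finset.mem_insert_self c {d}),
    if_pos (Finset.mem_insert_of_mem (Finset.mem_singleton_self d) : d ∈ ({c, d} : Finset (Fin n))), Finset.union_empty]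
    at hEw hEc' hEd'
  -- abbreviate the four off-`s₂` terms and the pair masses
  set yc : ℝ := (w s(s₂, c) : ℝ) with hyc
  set yd : ℝ := (w s(s₂, d) : ℝ) with hyd
  set Rw : ℝ := (prodBernoulli w).real {ω : BondConfig (Fin n) | (∀ x ∈ ({s₁, s₂} : Finset (Fin n)), ω ∉ openConn i x) ∧
        (A.filter fun z => ω ∈ openConn i z).card ≤ j} with hRw
  set Lw : ℝ := (prodBernoulli w).real {ω : BondConfig (Fin n) | (∀ x ∈ ({s₁, s₂} : Finset (Fin n)), ω ∉ openConn i x) ∧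
        1 ≤ (A.filter fun z => ∃ x ∈ ({s₁, s₂} : Finset (Fin n)), ω ∈ openConn x z).card ∧
        (A.filter fun z => ∃ x ∈ ({s₁, s₂} : Finset (Fin n)), ω ∈ openConn x z).card ≤ j} with hLw
  set Rc : ℝ := (prodBernoulli wc).real {ω : BondConfig (Fin n) | (∀ x ∈ ({s₁, s₂} : Finset (Fin n)), ω ∉ openConn i x) ∧
        (A.filter fun z => ω ∈ openConn i z).card ≤ j} with hRc
  set Lc : ℝ := (prodBernoulli wc).real {ω : BondConfig (Fin n) | (∀ x ∈ ({s₁, s₂} : Finset (Fin n)), ω ∉ openConn i x) ∧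
        1 ≤ (A.filter fun z => ∃ x ∈ ({s₁, s₂} : Finset (Fin n)), ω ∈ openConn x z).card ∧
        (A.filter fun z => ∃ x ∈ ({s₁, s₂} : Finset (Fin n)), ω ∈ openConn x z).card ≤ j} with hLc
  set Rd : ℝ := (prodBernoulli wd).real {ω : BondConfig (Fin n) | (∀ x ∈ ({s₁, s₂} : Finset (Fin n)), ω ∉ openConn i x) ∧
        (A.filter fun z => ω ∈ openConn i z).card ≤ j} with hRd
  set Ld : ℝ := (prodBernoulli wd).real {ω : BondConfig (Fin n) | (∀ x ∈ ({s₁, s₂} : Finset (Fin n)), ω ∉ openConn i x) ∧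
        1 ≤ (A.filter fun z => ∃ x ∈ ({s₁, s₂} : Finset (Fin n)), ω ∈ openConn x z).card ∧
        (A.filter fun z => ∃ x ∈ ({s₁, s₂} : Finset (Fin n)), ω ∈ openConn x z).card ≤ j} with hLd
  have hEc0 : Lc ≤ Rc := by convert hEc
  have hEd0 : Ld ≤ Rd := by convert hEd
  -- the algebra: (1 − Y)·(Rw − Lw) = ν_∅·DD + ν_c·E_c + ν_d·E_d
  obtain ⟨D, hDdef, hD⟩ : ∃ D : ℝ, D = _ ∧ 0 ≤ D := ⟨_, rfl, hDD⟩
  have key : (1 - yc * yd) * (Rw - Lw) =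
      (1 - yc) * (1 - yd) * D + yc * (1 - yd) * (Rc - Lc) + (1 - yc) * yd * (Rd - Ld) := by
    linear_combination (1 - yc * yd) * hEw - yc * (1 - yd) * hEc' - (1 - yc) * yd * hEd' - (1 - yc) * (1 - yd) * hDdef
  have hpos : 0 ≤ (1 - yc * yd) * (Rw - Lw) := by
    rw [key]
    refine add_nonneg (add_nonneg ?_ ?_) ?_
    · exact mul_nonneg (mul_nonneg (by linarith) (by linarith)) hD
    · exact mul_nonneg (mul_nonneg hyc0 (by linarith)) (by linarith [hEc0])
    · exact mul_nonneg (mul_nonneg (by linarith) hyd0) (by linarith [hEd0])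
  by_cases hY1 : yc * yd < 1
  · have h : (1 - yc * yd) * 0 ≤ (1 - yc * yd) * (Rw - Lw) := by rw [mul_zero]; exact hpos
    have := le_of_mul_le_mul_left h (by linarith)
    linarith
  · have hle1 : yc * yd ≤ yc := mul_le_of_le_one_right hyc0 hyd1
    have hle2 : yc * yd ≤ yd := mul_le_of_le_one_left hyd0 hyc1
    have hge : 1 ≤ yc * yd := not_lt.1 hY1
    have hyc' : yc = 1 := le_antisymm hyc1 (by linarith)
    have hyd' : yd = 1 := le_antisymm hyd1 (by linarith)
    rw [hyc', hyd'] at hEw hEc'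
    have : Rw - Lw = Rc - Lc := by linear_combination hEw - hEc'
    linarith [hEc0]

end Summit.CriticalPhenomena.PercolationContinuityZ3.Theorems

end
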